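import Literature.Analysis.FluidPDE.CompressibleEulerImplosionGraphBarrier
import Literature.Analysis.FluidPDE.CompressibleEulerImplosionLeftWedge
import Literature.Analysis.FluidPDE.CompressibleEulerImplosionNearAnalytic4
import Literature.Analysis.FluidPDE.CompressibleEulerImplosionBranchUniform
import Literature.Analysis.FluidPDE.CompressibleEulerImplosionShootingGlue
import HarnessLib

/-!
# Buckmaster–Cao-Labora–Gómez-Serrano at γ = 5/3: Proposition 3.1 from certified barriers (assembly)

The left half of the phase portrait argument, in abstract form. Fix `r ∈ (r₃, r₄)`, `r ≥ 11/10`.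
Suppose given (`LeftHyp r`):
* a near-`P_s` barrier `β_N(x) = Z₀ + B₁x + B₂x² + B₃x³ + b₄x⁴` (true `B₂, B₃`, free `b₄`) whose
  order-4 crossing polynomial `Q̃₄` is positive on `[−X, 0]` (so `G = x⁴ Q̃₄ > 0` and, by
  `sign_branch_sub_beta4Near`, the analytic branch starts above `β_N`);
* a `C¹` far barrier `bar` on the slab `[W₀ + x_e, W₀ − X + e₂]`, `W₀ + x_e < 9/10`, crossed
  upwards by the field (`G > 0`), above the sonic line `D_Z = 0`, below the diagonal, lying below
  `β_N` on the overlap and above the ray `Z = −(3/2)W` at `W = 9/10`.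
Then the smooth branch through `P_s` continues for all branch times `t > 0` as a solution of (1.8)
in `{D_W > 0, D_Z > 0, Z < W}` and tends to `P_∞ = (0,0)`: phase 1 (near barrier, until
`W = W₀ − X`), phase 2 (far barrier, until `W = 9/10`), phase 3 (the invariant wedge at `P_∞`,
`CompressibleEulerImplosionLeftWedge`); `W` decreases at rate `≥ 1/16` in phases 1–2
(`N_W ≤ −1/4` on the band `W ≥ 4/5` between the sonic line and the diagonal), so each phase ends,
and a maximal solution confined to these compact sets off the sonic lines is global.
The numerical hypotheses are discharged, window by window in `r`, by kernel certificates.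

[cite: BuckmasterCaolaboraGomezserrano2025, Prop. 3.1, Prop. 3.3, Prop. 3.5, §3, §6]
-/

noncomputable section

open Set Filter Topology

namespace Literature.Analysis.FluidPDE

namespace BuckmasterCaolaboraGomezserrano2025

namespace Monatomic

namespace LeftAsm

open SonicSeries NearPiece Wedge

variable {r : ℝ}

/-! ### The band estimate `N_W ≤ −1/4` -/

/-- On the band `4/5 ≤ W ≤ 3`, `−(3+W)/2 ≤ Z ≤ W` (between the sonic line `D_Z = 0` and the
diagonal), `N_W ≤ −1/4` for `r ≥ 11/10`; hence `W` decreases along solutions there.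
[cite: BuckmasterCaolaboraGomezserrano2025, Prop. 3.1] -/
theorem NW_band (hr : 11 / 10 ≤ r) {W Z : ℝ} (hW1 : 4 / 5 ≤ W)
    (hZ1 : -(3 + W) / 2 ≤ Z) (hZ2 : Z ≤ W) : NW r W Z ≤ -(1 / 4) := by
  have hq : 0 ≤ (Z + (3 + W) / 2) * (W - Z) := mul_nonneg (by linarith) (by linarith)
  unfold NW
  nlinarith [mul_nonneg (by linarith : (0:ℝ) ≤ W - 4 / 5) (by linarith : (0:ℝ) ≤ W + 3)]

/-- `W′ ≤ −1/16` on the band (with `D_W > 0`). [cite: BuckmasterCaolaboraGomezserrano2025, Prop. 3.1] -/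
theorem field_fst_band (hr : 11 / 10 ≤ r) {p : ℝ × ℝ} (hW1 : 4 / 5 ≤ p.1) (hW2 : p.1 ≤ 3)
    (hZ1 : -(3 + p.1) / 2 ≤ p.2) (hZ2 : p.2 ≤ p.1) (hDW : 0 < DW p.1 p.2) :
    (field r p).1 ≤ -(1 / 16) := by
  have hN := NW_band hr hW1 hZ1 hZ2
  have hD : DW p.1 p.2 ≤ 4 := by unfold DW; linarith
  show NW r p.1 p.2 / DW p.1 p.2 ≤ -(1 / 16)
  rw [div_le_iff₀ hDW]
  nlinarith

/-! ### First hitting time of a level by a continuous decreasing-type function -/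

/-- First time a continuous function reaches a level from above. [folklore] -/
theorem first_hit {W : ℝ → ℝ} {t₀ T lev : ℝ} (hcont : ∀ t ∈ Ico t₀ T, ContinuousAt W t)
    (h0 : lev < W t₀) (hex : ∃ t ∈ Ioo t₀ T, W t ≤ lev) :
    ∃ t₁ ∈ Ioo t₀ T, W t₁ = lev ∧ ∀ s ∈ Ico t₀ t₁, lev < W s := by
  obtain ⟨t, ht, hWt⟩ := hex
  set S : Set ℝ := {s | t₀ ≤ s ∧ s ≤ t ∧ W s ≤ lev} with hS
  have hne : S.Nonempty := ⟨t, ht.1.le, le_rfl, hWt⟩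
  have hbdd : BddBelow S := ⟨t₀, fun s hs => hs.1⟩
  set t₁ := sInf S with ht₁
  have ht₁t : t₁ ≤ t := csInf_le hbdd ⟨ht.1.le, le_rfl, hWt⟩
  have ht₀t₁ : t₀ ≤ t₁ := le_csInf hne fun s hs => hs.1
  have hbefore : ∀ s, t₀ ≤ s → s < t₁ → lev < W s := by
    intro s hs1 hs2
    by_contra hcon
    have hmem : s ∈ S := ⟨hs1, (hs2.le.trans ht₁t), not_lt.mp hcon⟩
    exact absurd (csInf_le hbdd hmem) (not_le.mpr hs2)
  -- `W t₁ ≤ lev` by closedness (continuity at `t₁`)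
  have ht₁T : t₁ < T := lt_of_le_of_lt ht₁t ht.2
  have hct₁ : ContinuousAt W t₁ := hcont t₁ ⟨ht₀t₁, ht₁T⟩
  have hle : W t₁ ≤ lev := by
    by_contra hcon
    have hgt : lev < W t₁ := not_le.mp hcon
    -- then `W > lev` on a neighbourhood of `t₁`, contradicting `t₁ = inf S`
    have hev : ∀ᶠ s in 𝓝 t₁, lev < W s := hct₁.eventually (lt_mem_nhds hgt)
    obtain ⟨ε, hε, hball⟩ := Metric.eventually_nhds_iff.mp hev
    -- some element of `S` is within `ε` of `t₁`
    obtain ⟨s, hsS, hslt⟩ := exists_lt_of_csInf_lt hne (show sInf S < t₁ + ε by linarith)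
    have hst₁ : t₁ ≤ s := csInf_le hbdd hsS
    have : lev < W s := hball (by rw [Real.dist_eq, abs_lt]; constructor <;> linarith)
    exact absurd hsS.2.2 (not_le.mpr this)
  have ht₀lt : t₀ < t₁ := by
    rcases eq_or_lt_of_le ht₀t₁ with h | h
    · rw [← h] at hle; exact absurd hle (not_le.mpr h0)
    · exact h
  -- `W t₁ ≥ lev` from the left
  have hge : lev ≤ W t₁ := by
    have hlim : Tendsto W (𝓝[<] t₁) (𝓝 (W t₁)) := hct₁.tendsto.mono_left nhdsWithin_le_nhds
    have hev : ∀ᶠ s in 𝓝[<] t₁, lev < W s := by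
      filter_upwards [Ioo_mem_nhdsLT ht₀lt] with s hs using hbefore s hs.1.le hs.2
    exact ge_of_tendsto hlim (hev.mono fun s hs => hs.le)
  exact ⟨t₁, ⟨ht₀lt, ht₁T⟩, le_antisymm hle hge, fun s hs => hbefore s hs.1 hs.2⟩

/-! ### The hypotheses (to be certified window by window) -/

/-- The certified data for the left barrier argument at a given `r`.
[cite: BuckmasterCaolaboraGomezserrano2025, Prop. 3.3, Prop. 3.5, App. B] -/
structure LeftHyp (r : ℝ) where
  /-- free quartic coefficient of the near piece -/
  b4 : ℝ
  /-- extent of the near piece -/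
  X : ℝ
  /-- overlap of the far slab beyond the junction -/
  e2 : ℝ
  /-- left end of the far slab, relative to `W₀` -/
  xe : ℝ
  /-- the far barrier (a `C¹` graph over `W`) -/
  bar : ℝ → ℝ
  hX : 0 < X
  hX1 : X ≤ 1
  he2 : 0 < e2
  he2X : e2 < X
  hxe : W0 r + xe < 9 / 10
  hc2 : cB2 r (Z0 r) (Z1 r / W1 r) ≠ 0
  hc3 : cB3 r (Z0 r) (Z1 r / W1 r) ≠ 0
  hQ : ∀ x ∈ Icc (-X) 0, 0 < Qt4Near r (Z0 r) (Z1 r / W1 r) b4 x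
  hnearD : ∀ x ∈ Ico (-X) 0, 0 < DZ (W0 r + x) (beta4Near r (Z0 r) (Z1 r / W1 r) b4 x) ∧
    0 < DW (W0 r + x) (beta4Near r (Z0 r) (Z1 r / W1 r) b4 x) ∧
    beta4Near r (Z0 r) (Z1 r / W1 r) b4 x < W0 r + x
  hbarc : Continuous bar
  hsmooth : ∀ w, W0 r + xe < w → w < W0 r - X + e2 → ∃ m, HasDerivAt bar m w ∧ 0 < Gfun r w (bar w) m
  hfarD : ∀ w ∈ Icc (W0 r + xe) (W0 r - X + e2), 0 < DZ w (bar w) ∧ 0 < DW w (bar w) ∧ bar w < w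
  hjunc : ∀ w ∈ Icc (W0 r - X) (W0 r - X + e2), bar w ≤ beta4Near r (Z0 r) (Z1 r / W1 r) b4 (w - W0 r)
  hhand : -(3 / 2) * (9 / 10) < bar (9 / 10)

/-- The conclusion: Proposition 3.1-type data for the branch through `P_s` at `r`.
[cite: BuckmasterCaolaboraGomezserrano2025, Prop. 3.1] -/
def LeftData (r : ℝ) : Prop :=
  ∃ (Wl Zl : ℝ → ℝ) (δ : ℝ), 0 < δ ∧
    (∀ t ∈ Ico 0 δ, Wl t = Wloc r t ∧ Zl t = Zloc r t) ∧
    (∀ t ∈ Ioi (0 : ℝ), HasDerivAt (fun x => (Wl x, Zl x)) (field r (Wl t, Zl t)) t) ∧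
    (∀ t ∈ Ioi (0 : ℝ), 0 < DW (Wl t) (Zl t) ∧ 0 < DZ (Wl t) (Zl t) ∧ Zl t < Wl t) ∧
    Tendsto Wl atTop (𝓝 0) ∧ Tendsto Zl atTop (𝓝 0)

/-! ### The main theorem -/

set_option maxHeartbeats 4000000 in
/-- **Proposition 3.1 at `γ = 5/3` from certified barriers.** [cite: BuckmasterCaolaboraGomezserrano2025, Prop. 3.1, Prop. 3.3, Prop. 3.5] -/
theorem leftData_of_hyp (h3 : r3 < r) (h4 : r < r4) (h11 : 11 / 10 ≤ r) (h28 : r ≤ 28 / 25)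
    (H : LeftHyp r) : LeftData r := by
  have hm := r3_r4_mem
  have h1 : 1 < r := hm.1.trans h3
  have hrs : r < rstar := h4.trans hm.2.2
  have hq79 : q r ≤ 79 / 100 := by
    have e : (79 / 100 : ℝ) = Real.sqrt ((79 / 100) ^ 2) := by rw [Real.sqrt_sq]; norm_num
    rw [e]; unfold q disc
    apply Real.sqrt_le_sqrt
    nlinarith [mul_nonneg (by linarith : (0:ℝ) ≤ r - 11 / 10) (by linarith : (0:ℝ) ≤ 49 / 10 - r)]
  have hq73 : 73 / 100 ≤ q r := by
    have e : (73 / 100 : ℝ) = Real.sqrt ((73 / 100) ^ 2) := by rw [Real.sqrt_sq]; norm_num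
    rw [e]; unfold q disc
    apply Real.sqrt_le_sqrt
    nlinarith [mul_nonneg (by linarith : (0:ℝ) ≤ 28 / 25 - r) (by linarith : (0:ℝ) ≤ 122 / 25 - r)]
  have hW0lo : 2 ≤ W0 r := by unfold W0; linarith
  have hW0hi : W0 r ≤ 13 / 5 := by unfold W0; linarith
  obtain ⟨b4, X, e2, xe, bar, hX, hX1, he2, he2X, hxe, hc2, hc3, hQ, hnearD, hbarc, hsmooth, hfarD,
    hjunc, hhand⟩ := H
  set βN : ℝ → ℝ := beta4Near r (Z0 r) (Z1 r / W1 r) b4 with hβN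
  -- 1. the branch near `P_s`, uniformly on `(0, δb]`
  obtain ⟨δb, hδb, hbu⟩ := branch_uniform h3 h4 le_rfl
  obtain ⟨hδρ, hbr⟩ := hbu r ⟨le_rfl, le_rfl⟩
  obtain ⟨hWl0, hZl0, hWl1, hZl1, hspec⟩ := sonicSeries_spec' h3 h4
  -- the analytic start: the branch is above `βN` on a punctured neighbourhood of `0`
  have hQ0 : 0 < (1:ℝ) * Qt4Near r (Z0 r) (Z1 r / W1 r) b4 0 := by
    rw [one_mul]; exact hQ 0 ⟨by linarith, le_rfl⟩
  have hsign := sign_branch_sub_beta4Near h3 h4 hc2 hc3 (Or.inl rfl) hQ0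
  have hsign' : ∀ᶠ s in 𝓝[>] (0:ℝ), βN (Wloc r s - W0 r) < Zloc r s := by
    have := hsign.filter_mono (nhdsWithin_mono _ (fun s (hs : s ∈ Ioi (0:ℝ)) => ne_of_gt hs))
    filter_upwards [this] with s hs
    rw [one_mul] at hs; simp only [hβN]; linarith
  -- continuity of `Wloc` at `0`
  have hρ : 0 < sonicRad r := sonicRad_pos hrs
  have hcW : ContinuousAt (Wloc r) 0 := ((hspec 0 (by rw [abs_zero]; exact hρ)).1).continuousAt
  have hWnear : ∀ᶠ s in 𝓝[>] (0:ℝ), W0 r - X / 2 < Wloc r s := by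
    have : ∀ᶠ s in 𝓝 (0:ℝ), W0 r - X / 2 < Wloc r s := by
      apply hcW.eventually (lt_mem_nhds _); rw [hWl0]; linarith
    exact mem_nhdsWithin_of_mem_nhds this
  obtain ⟨t₀, ⟨hZt₀, hWt₀⟩, ht₀, ht₀δ⟩ :=
    ((hsign'.and hWnear).and (Ioo_mem_nhdsGT hδb)).exists
  -- branch facts at times in `(0, δb]`
  have hbr' : ∀ t, 0 < t → t ≤ δb → 0 < DW (Wloc r t) (Zloc r t) ∧ 0 < DZ (Wloc r t) (Zloc r t) ∧
      Zloc r t < Wloc r t ∧ Wloc r t < W0 r := by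
    intro t ht1 ht2
    obtain ⟨⟨k1, k2, _, _⟩, _, k4⟩ := hbr t (by rw [abs_of_pos ht1]; exact ht2)
    exact ⟨k1, (k4 ht1).1, k2, (k4 ht1).2⟩
  -- 2. the branch as a solution on `(0, δb)`
  set c₀ : ℝ → ℝ × ℝ := fun t => (Wloc r t, Zloc r t) with hc₀
  have hc₀d : ∀ t ∈ Ioo 0 δb, HasDerivAt c₀ (field r (c₀ t)) t := by
    intro t ht
    obtain ⟨k1, k2, _⟩ := hbr' t ht.1 ht.2.le
    exact hasDerivAt_branch h3 h4 (by rw [abs_of_pos ht.1]; exact ht.2.trans hδρ) k1.ne' k2.ne'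
  have hc₀U : ∀ t ∈ Ioo 0 δb, c₀ t ∈ offSonic := by
    intro t ht
    obtain ⟨k1, k2, _⟩ := hbr' t ht.1 ht.2.le
    exact ⟨k1.ne', k2.ne'⟩
  have hF : ∀ p ∈ offSonic, ContDiffAt ℝ 1 (field r) p := fun p hp => contDiffAt_field_of_mem hp
  -- 3. the three compact regions
  obtain ⟨Wt, hWt⟩ : ∃ w : ℝ, w = Wloc r t₀ := ⟨_, rfl⟩
  have hWtW0 : Wt < W0 r := by rw [hWt]; exact (hbr' t₀ ht₀ ht₀δ.le).2.2.2
  have hWtX : W0 r - X / 2 < Wt := by rw [hWt]; exact hWt₀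
  have hZt₀' : βN (Wt - W0 r) < Zloc r t₀ := by rw [hWt]; exact hZt₀
  set R1 : Set (ℝ × ℝ) := {p | W0 r - X ≤ p.1 ∧ p.1 ≤ Wt ∧ βN (p.1 - W0 r) ≤ p.2 ∧ p.2 ≤ p.1} with hR1
  set R2 : Set (ℝ × ℝ) := {p | 9 / 10 ≤ p.1 ∧ p.1 ≤ W0 r - X + e2 ∧ bar p.1 ≤ p.2 ∧ p.2 ≤ p.1} with hR2
  have hβNc : Continuous βN := continuous_beta4Near _ _ _ _
  have hR1c : IsCompact R1 := by
    have hclosed : IsClosed R1 := by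
      have e : R1 = (fun p : ℝ × ℝ => p.1) ⁻¹' Icc (W0 r - X) Wt ∩
          ((fun p : ℝ × ℝ => βN (p.1 - W0 r) - p.2) ⁻¹' Iic 0 ∩ (fun p : ℝ × ℝ => p.2 - p.1) ⁻¹' Iic 0) := by
        ext p; simp only [hR1, mem_setOf_eq, mem_inter_iff, mem_preimage, mem_Icc, mem_Iic]
        constructor
        · rintro ⟨k1, k2, k3, k4⟩; exact ⟨⟨k1, k2⟩, by linarith, by linarith⟩
        · rintro ⟨⟨k1, k2⟩, k3, k4⟩; exact ⟨k1, k2, by linarith, by linarith⟩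
      rw [e]
      refine (isClosed_Icc.preimage continuous_fst).inter ((isClosed_Iic.preimage ?_).inter
        (isClosed_Iic.preimage (continuous_snd.sub continuous_fst)))
      exact (hβNc.comp (continuous_fst.sub continuous_const)).sub continuous_snd
    -- bounded: `W ∈ [W0 - X, Wt]`, `Z ∈ [min βN, W]`
    obtain ⟨M, hM⟩ := isCompact_Icc.exists_bound_of_continuousOn
      (f := fun w => βN (w - W0 r)) (s := Icc (W0 r - X) Wt) (hβNc.comp (continuous_id.sub continuous_const)).continuousOn
    refine (isCompact_closedBall (0 : ℝ × ℝ) (|M| + 3)).of_isClosed_subset hclosed fun p hp => ?_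
    obtain ⟨k1, k2, k3, k4⟩ := hp
    have hb := hM p.1 ⟨k1, k2⟩
    rw [Real.norm_eq_abs] at hb
    have hb' := (abs_le.mp hb).1
    rw [Metric.mem_closedBall, dist_zero_right, Prod.norm_def, Real.norm_eq_abs, Real.norm_eq_abs]
    have hMa := le_abs_self M
    have hMa' := neg_abs_le M
    exact max_le (abs_le.mpr ⟨by linarith, by linarith⟩) (abs_le.mpr ⟨by linarith, by linarith⟩)
  have hR2c : IsCompact R2 := by
    have hclosed : IsClosed R2 := by
      have e : R2 = (fun p : ℝ × ℝ => p.1) ⁻¹' Icc (9 / 10) (W0 r - X + e2) ∩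
          ((fun p : ℝ × ℝ => bar p.1 - p.2) ⁻¹' Iic 0 ∩ (fun p : ℝ × ℝ => p.2 - p.1) ⁻¹' Iic 0) := by
        ext p; simp only [hR2, mem_setOf_eq, mem_inter_iff, mem_preimage, mem_Icc, mem_Iic]
        constructor
        · rintro ⟨k1, k2, k3, k4⟩; exact ⟨⟨k1, k2⟩, by linarith, by linarith⟩
        · rintro ⟨⟨k1, k2⟩, k3, k4⟩; exact ⟨k1, k2, by linarith, by linarith⟩
      rw [e]
      refine (isClosed_Icc.preimage continuous_fst).inter ((isClosed_Iic.preimage ?_).inter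
        (isClosed_Iic.preimage (continuous_snd.sub continuous_fst)))
      exact (hbarc.comp continuous_fst).sub continuous_snd
    obtain ⟨M, hM⟩ := isCompact_Icc.exists_bound_of_continuousOn
      (f := bar) (s := Icc (9 / 10) (W0 r - X + e2)) hbarc.continuousOn
    refine (isCompact_closedBall (0 : ℝ × ℝ) (|M| + 3)).of_isClosed_subset hclosed fun p hp => ?_
    obtain ⟨k1, k2, k3, k4⟩ := hp
    have hb := hM p.1 ⟨k1, k2⟩
    rw [Real.norm_eq_abs] at hb
    have hb' := (abs_le.mp hb).1
    rw [Metric.mem_closedBall, dist_zero_right, Prod.norm_def, Real.norm_eq_abs, Real.norm_eq_abs]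
    have hMa := le_abs_self M
    have hMa' := neg_abs_le M
    exact max_le (abs_le.mpr ⟨by linarith, by linarith⟩) (abs_le.mpr ⟨by linarith, by linarith⟩)
  -- the regions are off the sonic lines, with the needed estimates
  have hR1D : ∀ p ∈ R1, 0 < DW p.1 p.2 ∧ 0 < DZ p.1 p.2 := by
    intro p hp
    obtain ⟨k1, k2, k3, k4⟩ := hp
    have hx : p.1 - W0 r ∈ Ico (-X) 0 := ⟨by linarith, by linarith⟩
    obtain ⟨hDZ, hDW, _⟩ := hnearD _ hx
    rw [show W0 r + (p.1 - W0 r) = p.1 by ring] at hDZ hDW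
    constructor
    · unfold DW at hDW ⊢; linarith
    · unfold DZ at hDZ ⊢; linarith
  have hR2D : ∀ p ∈ R2, 0 < DW p.1 p.2 ∧ 0 < DZ p.1 p.2 := by
    intro p hp
    obtain ⟨k1, k2, k3, k4⟩ := hp
    obtain ⟨hDZ, hDW, _⟩ := hfarD p.1 ⟨by linarith, k2⟩
    constructor
    · unfold DW at hDW ⊢; linarith
    · unfold DZ at hDZ ⊢; linarith
  set Kbig : Set (ℝ × ℝ) := R1 ∪ R2 ∪ Kc with hKbig
  have hKbigc : IsCompact Kbig := (hR1c.union hR2c).union isCompact_Kc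
  have hKbigU : Kbig ⊆ offSonic := by
    rintro p ((hp | hp) | hp)
    · exact ⟨(hR1D p hp).1.ne', (hR1D p hp).2.ne'⟩
    · exact ⟨(hR2D p hp).1.ne', (hR2D p hp).2.ne'⟩
    · exact Kc_subset_offSonic hp
  -- 4. the key dynamical statement: for a continuation `c` of the branch on `(0, T)`,
  --    the three phases; we prove it for any `T` together with the global/finite alternative.
  -- time budget: `W` drops at rate ≥ 1/16 from `Wt ≤ 13/5` to `9/10`
  -- pointwise facts in the regions
  have hband1 : ∀ p ∈ R1, (field r p).1 ≤ -(1 / 16) := by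
    intro p hp
    obtain ⟨k1, k2, k3, k4⟩ := hp
    have hx : p.1 - W0 r ∈ Ico (-X) 0 := ⟨by linarith, by linarith⟩
    obtain ⟨hDZ, hDW, _⟩ := hnearD _ hx
    rw [show W0 r + (p.1 - W0 r) = p.1 by ring] at hDZ hDW
    refine field_fst_band h11 (by linarith) (by linarith) ?_ k4 ?_
    · unfold DZ at hDZ; linarith
    · unfold DW at hDW ⊢; linarith
  have hband2 : ∀ p ∈ R2, (field r p).1 ≤ -(1 / 16) := by
    intro p hp
    obtain ⟨k1, k2, k3, k4⟩ := hp
    obtain ⟨hDZ, hDW, _⟩ := hfarD p.1 ⟨by linarith, k2⟩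
    refine field_fst_band h11 (by linarith) (by linarith) ?_ k4 ?_
    · unfold DZ at hDZ; linarith
    · unfold DW at hDW ⊢; linarith
  have key : ∀ (c : ℝ → ℝ × ℝ) (T : ℝ), EqOn c c₀ (Ioo 0 δb) →
      (∀ t ∈ Ioo 0 T, HasDerivAt c (field r (c t)) t) → (∀ t ∈ Ioo 0 T, c t ∈ offSonic) → t₀ < T →
      (t₀ + (81 : ℝ) ≤ T ∨ ∃ δ > (0:ℝ), ∀ t ∈ Ioo 0 T, T - δ < t → c t ∉ Kbig) →
      ∃ t₂ ∈ Ioo t₀ T, t₂ ≤ t₀ + (81 : ℝ) - 1 ∧ InW (9 / 10) (c t₂) ∧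
        (∀ t ∈ Icc t₀ t₂, c t ∈ Kbig) ∧ (∀ t ∈ Ico t₂ T, InW (9 / 10) (c t)) := by
    intro c T hce hcd hcU ht₀T halt
    have hct₀ : c t₀ = (Wloc r t₀, Zloc r t₀) := hce ⟨ht₀, ht₀δ⟩
    have hcW0 : (c t₀).1 = Wt := by rw [hct₀, hWt]
    have hcZ0 : (c t₀).2 = Zloc r t₀ := by rw [hct₀]
    have hUne : ∀ t ∈ Ioo 0 T, DW (c t).1 (c t).2 ≠ 0 ∧ DZ (c t).1 (c t).2 ≠ 0 := fun t ht => hcU t ht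
    have hbt₀ := hbr' t₀ ht₀ ht₀δ.le
    have hdiag : ∀ t ∈ Ioo 0 T, (c t).2 < (c t).1 :=
      snd_lt_fst_of_solution hcd hUne ⟨ht₀, ht₀T⟩ (by rw [hct₀]; exact hbt₀.2.2.1)
    have hccont : ∀ t ∈ Ioo 0 T, ContinuousAt c t := fun t ht => (hcd t ht).continuousAt
    -- decay of `W` while in a region with `W' ≤ -1/16`
    have hdecay : ∀ (a b : ℝ), t₀ ≤ a → a ≤ b → b < T →
        (∀ s ∈ Ico a b, (field r (c s)).1 ≤ -(1 / 16)) → (c b).1 ≤ (c a).1 - (b - a) / 16 := by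
      intro a b ha hab hbT hW'
      have hd : ∀ s ∈ Icc a b, HasDerivAt (fun s => (c s).1 + s / 16) ((field r (c s)).1 + 1 / 16) s := by
        intro s hs
        have h1 := (hcd s ⟨by linarith [hs.1], lt_of_le_of_lt hs.2 hbT⟩).fst
        have h2 : HasDerivAt (fun x : ℝ => x / 16) (1 / 16) s := (hasDerivAt_id s).div_const 16
        exact HasDerivAt.add h1 h2
      have hanti : AntitoneOn (fun s => (c s).1 + s / 16) (Icc a b) := by
        apply antitoneOn_of_deriv_nonpos (convex_Icc _ _)
        · exact fun s hs => (hd s hs).continuousAt.continuousWithinAt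
        · rw [interior_Icc]; exact fun s hs => (hd s ⟨hs.1.le, hs.2.le⟩).differentiableAt.differentiableWithinAt
        · rw [interior_Icc]; intro s hs
          rw [(hd s ⟨hs.1.le, hs.2.le⟩).deriv]
          have := hW' s ⟨hs.1.le, hs.2⟩
          linarith
      have := hanti ⟨le_rfl, hab⟩ ⟨hab, le_rfl⟩ hab
      simp only at this
      linarith
    -- closedness of a graph constraint at a right endpoint
    have hclosed : ∀ (g : ℝ × ℝ → ℝ), Continuous g → ∀ (a b : ℝ), a < b → b < T → t₀ ≤ a →
        (∀ s ∈ Ico a b, g (c s) ≤ 0) → g (c b) ≤ 0 := by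
      intro g hg a b hab hbT ha hle
      have hcb : ContinuousAt c b := hccont b ⟨by linarith, hbT⟩
      have hlim : Tendsto (fun s => g (c s)) (𝓝[<] b) (𝓝 (g (c b))) :=
        ((hg.continuousAt.comp hcb).tendsto).mono_left nhdsWithin_le_nhds
      have hev : ∀ᶠ s in 𝓝[<] b, g (c s) ≤ 0 := by
        filter_upwards [Ioo_mem_nhdsLT hab] with s hs using hle s ⟨hs.1.le, hs.2⟩
      exact le_of_tendsto hlim hev
    ------------------------------------------------------------------
    -- PHASE 1: the near barrier, while `W > W0 - X`
    ------------------------------------------------------------------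
    -- trapping on any `[t₀, b)` on which `W > (W0 r - X)`
    have trap1 : ∀ b, t₀ < b → b ≤ T → (∀ s ∈ Ico t₀ b, (W0 r - X) < (c s).1) → ∀ s ∈ Ico t₀ b, c s ∈ R1 := by
      intro b hb hbT hlev s hs
      -- two constraints: `βN(W - W0) - Z ≤ 0` and `W - Wt ≤ 0`
      set g : Fin 2 → ℝ → ℝ := fun i => match i with
        | 0 => fun s => βN ((c s).1 - W0 r) - (c s).2
        | 1 => fun s => (c s).1 - Wt with hg
      set g' : Fin 2 → ℝ → ℝ := fun i => match i with
        | 0 => fun s => dbeta4Near r (Z0 r) (Z1 r / W1 r) b4 ((c s).1 - W0 r) * (field r (c s)).1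
            - (field r (c s)).2
        | 1 => fun s => (field r (c s)).1 with hg'
      have hgd : ∀ i, ∀ ξ ∈ Ico t₀ b, HasDerivAt (g i) (g' i ξ) ξ := by
        intro i ξ hξ
        have hcξ := hcd ξ ⟨by linarith [hξ.1], lt_of_lt_of_le hξ.2 hbT⟩
        fin_cases i
        · have h1 : HasDerivAt (fun s => (c s).1 - W0 r) (field r (c ξ)).1 ξ := hcξ.fst.sub_const _
          have h2 := (hasDerivAt_beta4Near r (Z0 r) (Z1 r / W1 r) b4 ((c ξ).1 - W0 r)).comp ξ h1
          exact h2.sub hcξ.snd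
        · exact hcξ.fst.sub_const _
      have hg0 : ∀ i, g i t₀ ≤ 0 := by
        intro i
        fin_cases i
        · show βN ((c t₀).1 - W0 r) - (c t₀).2 ≤ 0
          rw [hcW0, hcZ0]; linarith [hZt₀']
        · show (c t₀).1 - Wt ≤ 0
          rw [hcW0]; linarith
      have hkey : ∀ ξ ∈ Ico t₀ b, (∀ j, g j ξ ≤ 0) → ∀ i, g i ξ = 0 → g' i ξ < 0 := by
        intro ξ hξ hall i hi
        have k0 : βN ((c ξ).1 - W0 r) - (c ξ).2 ≤ 0 := hall 0
        have k1 : (c ξ).1 - Wt ≤ 0 := hall 1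
        have hW := hlev ξ hξ
        have hx : (c ξ).1 - W0 r ∈ Ico (-X) 0 := ⟨by linarith, by linarith⟩
        obtain ⟨hDZb, hDWb, hbW⟩ := hnearD _ hx
        rw [show W0 r + ((c ξ).1 - W0 r) = (c ξ).1 by ring] at hDZb hDWb hbW
        have hZW := hdiag ξ ⟨by linarith [hξ.1], lt_of_lt_of_le hξ.2 hbT⟩
        have hDW : 0 < DW (c ξ).1 (c ξ).2 := by unfold DW at hDWb ⊢; linarith
        have hDZ : 0 < DZ (c ξ).1 (c ξ).2 := by unfold DZ at hDZb ⊢; linarith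
        have hmem : c ξ ∈ R1 := ⟨by linarith, by linarith, by linarith, hZW.le⟩
        fin_cases i
        · -- on the near barrier: `G = x⁴ Q̃₄ > 0`
          have hZ : (c ξ).2 = βN ((c ξ).1 - W0 r) := by
            have : βN ((c ξ).1 - W0 r) - (c ξ).2 = 0 := hi
            linarith
          set x := (c ξ).1 - W0 r with hxdef
          have hxneg : x < 0 := by simp only [hxdef]; linarith
          have hd := (disc_pos hrs).le
          have hqq : q r ≠ 0 := (q_pos hrs).ne'
          have hW1ne : W1 r ≠ 0 := by unfold W1; exact mul_ne_zero (by norm_num) hqq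
          have hB1 : W1 r * (Z1 r / W1 r) = Z1 r := by field_simp
          have hfac := Gfun_beta4Near_eq r (Z0 r) (Z1 r / W1 r) b4 x (q0_Ps hd)
            (q1_Ps h1.le hd hqq hB1) hc2 hc3
          rw [← W0_eq_Z0] at hfac
          have hGpos : 0 < Gfun r (W0 r + x) (βN x) (dbeta4Near r (Z0 r) (Z1 r / W1 r) b4 x) := by
            simp only [hβN]; rw [hfac]
            have hx4 : 0 < x ^ 4 := Even.pow_pos (by decide) hxneg.ne
            exact mul_pos hx4 (hQ x ⟨hx.1, hx.2.le⟩)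
          have hWx : W0 r + x = (c ξ).1 := by simp only [hxdef]; ring
          rw [hWx] at hGpos
          -- `g' 0 = -(Z' - m W') = -G/(D_W D_Z)`
          show dbeta4Near r (Z0 r) (Z1 r / W1 r) b4 ((c ξ).1 - W0 r) * (field r (c ξ)).1
            - (field r (c ξ)).2 < 0
          have e := field_snd_sub_mul_fst (r := r)
            (m := dbeta4Near r (Z0 r) (Z1 r / W1 r) b4 x) hDW.ne' hDZ.ne'
          rw [show ((c ξ).1, (c ξ).2) = c ξ from rfl] at e
          have hpos : 0 < Gfun r (c ξ).1 (c ξ).2 (dbeta4Near r (Z0 r) (Z1 r / W1 r) b4 x)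
              / (DW (c ξ).1 (c ξ).2 * DZ (c ξ).1 (c ξ).2) := by
            rw [hZ]; exact div_pos hGpos (mul_pos (by rw [← hZ]; exact hDW) (by rw [← hZ]; exact hDZ))
          rw [← e] at hpos
          rw [← hxdef]
          linarith
        · -- `W = Wt`: `W' < 0`
          show (field r (c ξ)).1 < 0
          linarith [hband1 _ hmem]
      have hall := ODE.forall_le_zero_of_deriv_neg hgd hg0 hkey s hs
      have k0 : βN ((c s).1 - W0 r) - (c s).2 ≤ 0 := hall 0
      have k1 : (c s).1 - Wt ≤ 0 := hall 1
      have hZW := hdiag s ⟨by linarith [hs.1], lt_of_lt_of_le hs.2 hbT⟩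
      exact ⟨(hlev s hs).le, by linarith, by linarith, hZW.le⟩
    -- the first phase ends
    have hex1 : ∃ t ∈ Ioo t₀ T, (c t).1 ≤ (W0 r - X) := by
      by_contra hcon
      have hcon' : ∀ t ∈ Ioo t₀ T, (W0 r - X) < (c t).1 := fun t ht =>
        not_le.mp fun hle => hcon ⟨t, ht, hle⟩
      have hlev : ∀ s ∈ Ico t₀ T, (W0 r - X) < (c s).1 := by
        intro s hs
        rcases eq_or_lt_of_le hs.1 with h | h
        · rw [← h, hcW0]; linarith
        · exact hcon' s ⟨h, hs.2⟩
      have hin : ∀ s ∈ Ico t₀ T, c s ∈ R1 := trap1 T ht₀T le_rfl hlev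
      rcases halt with hT | ⟨δ, hδ, hout⟩
      · -- too long: `W` would drop below `(W0 r - X)`
        have hb : t₀ + ((81 : ℝ) - 1) < T := by linarith
        have hdrop := hdecay t₀ (t₀ + ((81 : ℝ) - 1)) le_rfl (by linarith) hb
          (fun s hs => hband1 _ (hin s ⟨hs.1, lt_trans hs.2 hb⟩))
        have hWend := hlev (t₀ + ((81 : ℝ) - 1)) ⟨by linarith, hb⟩
        rw [hcW0] at hdrop
        norm_num at hdrop hWend
        linarith
      · -- escape: but `c` stays in `R1 ⊆ Kbig`
        set t := max t₀ (T - δ / 2) with ht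
        have ht1 : t₀ ≤ t := le_max_left _ _
        have ht2 : t < T := max_lt ht₀T (by linarith)
        have ht3 : T - δ < t := lt_of_lt_of_le (by linarith) (le_max_right _ _)
        exact hout t ⟨by linarith, ht2⟩ ht3 (Or.inl (Or.inl (hin t ⟨ht1, ht2⟩)))
    have hcontW : ∀ t ∈ Ico t₀ T, ContinuousAt (fun s => (c s).1) t := fun t ht =>
      (hccont t ⟨by linarith [ht.1], ht.2⟩).fst
    obtain ⟨t₁, ht₁, hWt₁, hbefore1⟩ := first_hit hcontW (by rw [hcW0]; linarith) hex1
    have hin1 : ∀ s ∈ Ico t₀ t₁, c s ∈ R1 := trap1 t₁ ht₁.1 ht₁.2.le hbefore1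
    have hin1' : c t₁ ∈ R1 := by
      refine ⟨by rw [hWt₁], by rw [hWt₁]; linarith, ?_, (hdiag t₁ ⟨by linarith [ht₁.1], ht₁.2⟩).le⟩
      have key1 : βN ((c t₁).1 - W0 r) - (c t₁).2 ≤ 0 :=
        hclosed (fun p => βN (p.1 - W0 r) - p.2)
          ((hβNc.comp (continuous_fst.sub continuous_const)).sub continuous_snd)
          t₀ t₁ ht₁.1 ht₁.2 le_rfl (fun s hs => by
            show βN ((c s).1 - W0 r) - (c s).2 ≤ 0
            have := (hin1 s hs).2.2.1; linarith)
      linarith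
    have ht₁le : t₁ ≤ t₀ + 16 * 2 := by
      have hdrop := hdecay t₀ t₁ le_rfl ht₁.1.le ht₁.2 (fun s hs => hband1 _ (hin1 s hs))
      rw [hcW0, hWt₁] at hdrop
      linarith
    ------------------------------------------------------------------
    -- PHASE 2: the far barrier, while `W > 9/10`
    ------------------------------------------------------------------
    have hZt₁ : bar (c t₁).1 ≤ (c t₁).2 := by
      have hj := hjunc (c t₁).1 ⟨by rw [hWt₁], by rw [hWt₁]; linarith⟩
      have := hin1'.2.2.1
      linarith
    have trap2 : ∀ b, t₁ < b → b ≤ T → (∀ s ∈ Ico t₁ b, (9 / 10 : ℝ) < (c s).1) → ∀ s ∈ Ico t₁ b, c s ∈ R2 := by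
      intro b hb hbT hlev s hs
      set g : Fin 2 → ℝ → ℝ := fun i => match i with
        | 0 => fun s => bar (c s).1 - (c s).2
        | 1 => fun s => (c s).1 - (W0 r - X + e2 / 2) with hg
      -- derivative of `bar ∘ W`: use the derivative provided by `hsmooth` where available,
      -- and `0`-placeholder elsewhere (only points in the slab matter)
      have hsl : ∀ ξ ∈ Ico t₁ b, (∀ j, g j ξ ≤ 0) → W0 r + xe < (c ξ).1 ∧ (c ξ).1 < W0 r - X + e2 := by
        intro ξ hξ hall
        have k1 : (c ξ).1 - (W0 r - X + e2 / 2) ≤ 0 := hall 1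
        exact ⟨by linarith [hlev ξ hξ], by linarith⟩
      -- we run the trapping lemma on the maximal subinterval where `W` stays in the open slab;
      -- simpler: the slab condition follows from the constraints, so define `g' 0` via `hsmooth`
      -- at slab points and arbitrarily elsewhere.
      classical
      set mfun : ℝ → ℝ := fun w => if h : W0 r + xe < w ∧ w < W0 r - X + e2 then
        Classical.choose (hsmooth w h.1 h.2) else 0 with hmfun
      have hmspec : ∀ w, W0 r + xe < w → w < W0 r - X + e2 →
          HasDerivAt bar (mfun w) w ∧ 0 < Gfun r w (bar w) (mfun w) := by
        intro w hw1 hw2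
        have h : W0 r + xe < w ∧ w < W0 r - X + e2 := ⟨hw1, hw2⟩
        simp only [hmfun, dif_pos h]
        exact Classical.choose_spec (hsmooth w h.1 h.2)
      -- first show the slab condition holds on all of `Ico t₁ b` by an auxiliary trapping with
      -- the single smooth constraint `W ≤ W0 - X + e2/2` (whose maintenance needs `Z ≥ bar W`) —
      -- to avoid circularity we trap both constraints simultaneously, supplying the derivative of
      -- `g 0` only at points of the slab: `forall_le_zero_of_deriv_neg` needs `HasDerivAt (g 0)`
      -- at every point of `Ico t₁ b`, so we restrict to the subinterval where the slab condition
      -- is known, obtained by continuity, and bootstrap with `first_hit`.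
      -- The slab condition `W < W0 - X + e2` is open; let `b'` be the first time it fails (if any).
      have hWt₁' : (c t₁).1 < W0 r - X + e2 := by rw [hWt₁]; linarith
      -- claim: for every `b' ≤ b` such that the slab condition holds on `Ico t₁ b'`, constraints hold there
      have inner : ∀ b', t₁ < b' → b' ≤ b → (∀ s ∈ Ico t₁ b', (c s).1 < W0 r - X + e2) →
          ∀ s ∈ Ico t₁ b', bar (c s).1 ≤ (c s).2 ∧ (c s).1 ≤ W0 r - X + e2 / 2 := by
        intro b' hb' hb'b hslab s hs
        set g' : Fin 2 → ℝ → ℝ := fun i => match i with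
          | 0 => fun s => mfun (c s).1 * (field r (c s)).1 - (field r (c s)).2
          | 1 => fun s => (field r (c s)).1 with hg'
        have hgd : ∀ i, ∀ ξ ∈ Ico t₁ b', HasDerivAt (g i) (g' i ξ) ξ := by
          intro i ξ hξ
          have hξT : ξ < T := lt_of_lt_of_le (lt_of_lt_of_le hξ.2 hb'b) hbT
          have hcξ := hcd ξ ⟨by linarith [hξ.1, ht₁.1], hξT⟩
          fin_cases i
          · have hw1 : W0 r + xe < (c ξ).1 := by linarith [hlev ξ ⟨hξ.1, lt_of_lt_of_le hξ.2 hb'b⟩]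
            have hw2 := hslab ξ hξ
            exact ((hmspec _ hw1 hw2).1.comp ξ hcξ.fst).sub hcξ.snd
          · exact hcξ.fst.sub_const _
        have hg0 : ∀ i, g i t₁ ≤ 0 := by
          intro i; fin_cases i
          · show bar (c t₁).1 - (c t₁).2 ≤ 0; linarith
          · show (c t₁).1 - (W0 r - X + e2 / 2) ≤ 0; rw [hWt₁]; linarith
        have hkey : ∀ ξ ∈ Ico t₁ b', (∀ j, g j ξ ≤ 0) → ∀ i, g i ξ = 0 → g' i ξ < 0 := by
          intro ξ hξ hall i hi
          have k0 : bar (c ξ).1 - (c ξ).2 ≤ 0 := hall 0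
          have k1 : (c ξ).1 - (W0 r - X + e2 / 2) ≤ 0 := hall 1
          have hξT : ξ < T := lt_of_lt_of_le (lt_of_lt_of_le hξ.2 hb'b) hbT
          have hW := hlev ξ ⟨hξ.1, lt_of_lt_of_le hξ.2 hb'b⟩
          have hw1 : W0 r + xe < (c ξ).1 := by linarith
          have hw2 : (c ξ).1 < W0 r - X + e2 := by linarith
          obtain ⟨hDZb, hDWb, hbW⟩ := hfarD (c ξ).1 ⟨hw1.le, hw2.le⟩
          have hZW := hdiag ξ ⟨by linarith [hξ.1, ht₁.1], hξT⟩
          have hDW : 0 < DW (c ξ).1 (c ξ).2 := by unfold DW at hDWb ⊢; linarith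
          have hDZ : 0 < DZ (c ξ).1 (c ξ).2 := by unfold DZ at hDZb ⊢; linarith
          have hmem : c ξ ∈ R2 := ⟨hW.le, by linarith, by linarith, hZW.le⟩
          fin_cases i
          · have hZ : (c ξ).2 = bar (c ξ).1 := by
              have : bar (c ξ).1 - (c ξ).2 = 0 := hi
              linarith
            obtain ⟨_, hG⟩ := hmspec _ hw1 hw2
            show mfun (c ξ).1 * (field r (c ξ)).1 - (field r (c ξ)).2 < 0
            have e := field_snd_sub_mul_fst (r := r) (m := mfun (c ξ).1) hDW.ne' hDZ.ne'
            rw [show ((c ξ).1, (c ξ).2) = c ξ from rfl] at e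
            have hpos : 0 < Gfun r (c ξ).1 (c ξ).2 (mfun (c ξ).1)
                / (DW (c ξ).1 (c ξ).2 * DZ (c ξ).1 (c ξ).2) := by
              apply div_pos _ (mul_pos hDW hDZ)
              rw [hZ]; exact hG
            rw [← e] at hpos
            linarith
          · show (field r (c ξ)).1 < 0
            linarith [hband2 _ hmem]
        have hall := ODE.forall_le_zero_of_deriv_neg hgd hg0 hkey s hs
        have k0 : bar (c s).1 - (c s).2 ≤ 0 := hall 0
        have k1 : (c s).1 - (W0 r - X + e2 / 2) ≤ 0 := hall 1
        exact ⟨by linarith, by linarith⟩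
      -- bootstrap: the slab condition holds on all of `Ico t₁ b`
      have hslab : ∀ s ∈ Ico t₁ b, (c s).1 < W0 r - X + e2 := by
        by_contra hcon
        have hcon' : ∃ s₀ ∈ Ico t₁ b, W0 r - X + e2 ≤ (c s₀).1 := by
          by_contra h'
          exact hcon fun s hs => not_le.mp fun hle => h' ⟨s, hs, hle⟩
        obtain ⟨s₀, hs₀, hbad⟩ := hcon'
        -- first time `W ≥ W0 - X + e2`
        have hcont' : ∀ t ∈ Ico t₁ b, ContinuousAt (fun s => -(c s).1) t := fun t ht =>
          (hccont t ⟨by linarith [ht.1, ht₁.1], lt_of_lt_of_le ht.2 hbT⟩).fst.neg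
        have hs₀' : t₁ < s₀ := by
          rcases eq_or_lt_of_le hs₀.1 with h | h
          · rw [← h] at hbad; linarith
          · exact h
        obtain ⟨b', hb', hWb', hbef⟩ := first_hit (W := fun s => -(c s).1) (lev := -(W0 r - X + e2)) hcont'
          (by show -(W0 r - X + e2) < -(c t₁).1; linarith) ⟨s₀, ⟨hs₀', hs₀.2⟩, by show -(c s₀).1 ≤ -(W0 r - X + e2); linarith⟩
        have hbef' : ∀ s ∈ Ico t₁ b', (c s).1 < W0 r - X + e2 := fun s hs => by
          have : -(W0 r - X + e2) < -(c s).1 := hbef s hs; linarith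
        have hin := inner b' hb'.1 hb'.2.le hbef'
        -- at `b'`: `W ≤ W0 - X + e2/2` by closedness, contradiction with `W b' = W0 - X + e2`
        have hle : (c b').1 - (W0 r - X + e2 / 2) ≤ 0 :=
          hclosed (fun p => p.1 - (W0 r - X + e2 / 2)) (continuous_fst.sub continuous_const)
            t₁ b' hb'.1 (lt_of_lt_of_le hb'.2 hbT) ht₁.1.le (fun s hs => by
              show (c s).1 - (W0 r - X + e2 / 2) ≤ 0
              have := (hin s hs).2; linarith)
        have hWb'' : -(c b').1 = -(W0 r - X + e2) := hWb'
        linarith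
      have hfin := inner b hb le_rfl hslab s hs
      have hsT : s < T := lt_of_lt_of_le hs.2 hbT
      exact ⟨(hlev s hs).le, by linarith [hfin.2], hfin.1, (hdiag s ⟨by linarith [hs.1, ht₁.1], hsT⟩).le⟩
    -- the second phase ends
    have ht₁T : t₁ < T := ht₁.2
    have hex2 : ∃ t ∈ Ioo t₁ T, (c t).1 ≤ (9 / 10 : ℝ) := by
      by_contra hcon
      have hcon' : ∀ t ∈ Ioo t₁ T, (9 / 10 : ℝ) < (c t).1 := fun t ht =>
        not_le.mp fun hle => hcon ⟨t, ht, hle⟩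
      have hlev : ∀ s ∈ Ico t₁ T, (9 / 10 : ℝ) < (c s).1 := by
        intro s hs
        rcases eq_or_lt_of_le hs.1 with h | h
        · rw [← h, hWt₁]; linarith
        · exact hcon' s ⟨h, hs.2⟩
      have hin : ∀ s ∈ Ico t₁ T, c s ∈ R2 := trap2 T ht₁T le_rfl hlev
      rcases halt with hT | ⟨δ, hδ, hout⟩
      · have hb : t₁ + 16 * 2 < T := by linarith
        have hdrop := hdecay t₁ (t₁ + 16 * 2) ht₁.1.le (by linarith) hb
          (fun s hs => hband2 _ (hin s ⟨hs.1, lt_trans hs.2 hb⟩))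
        obtain ⟨k1, k2, _⟩ := hin (t₁ + 16 * 2) ⟨by linarith, hb⟩
        rw [hWt₁] at hdrop
        linarith
      · set t := max t₁ (T - δ / 2) with ht
        have ht1 : t₁ ≤ t := le_max_left _ _
        have ht2 : t < T := max_lt ht₁T (by linarith)
        have ht3 : T - δ < t := lt_of_lt_of_le (by linarith) (le_max_right _ _)
        exact hout t ⟨by linarith [ht₁.1], ht2⟩ ht3 (Or.inl (Or.inr (hin t ⟨ht1, ht2⟩)))
    have hcontW2 : ∀ t ∈ Ico t₁ T, ContinuousAt (fun s => (c s).1) t := fun t ht =>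
      (hccont t ⟨by linarith [ht.1, ht₁.1], ht.2⟩).fst
    obtain ⟨t₂, ht₂, hWt₂, hbefore2⟩ := first_hit hcontW2 (by rw [hWt₁]; linarith) hex2
    have hin2 : ∀ s ∈ Ico t₁ t₂, c s ∈ R2 := trap2 t₂ ht₂.1 ht₂.2.le hbefore2
    have hZt₂ : bar (c t₂).1 ≤ (c t₂).2 := by
      have key2 : bar (c t₂).1 - (c t₂).2 ≤ 0 :=
        hclosed (fun p => bar p.1 - p.2) ((hbarc.comp continuous_fst).sub continuous_snd)
          t₁ t₂ ht₂.1 ht₂.2 ht₁.1.le (fun s hs => by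
            show bar (c s).1 - (c s).2 ≤ 0
            have := (hin2 s hs).2.2.1; linarith)
      linarith
    have ht₂le : t₂ ≤ t₁ + 16 * 2 := by
      have hdrop := hdecay t₁ t₂ ht₁.1.le ht₂.1.le ht₂.2 (fun s hs => hband2 _ (hin2 s hs))
      rw [hWt₁, hWt₂] at hdrop
      linarith
    ------------------------------------------------------------------
    -- PHASE 3: the wedge
    ------------------------------------------------------------------
    have hInW₂ : InW (9 / 10) (c t₂) := by
      refine ⟨by rw [hWt₂]; norm_num, by rw [hWt₂], ?_, hdiag t₂ ⟨by linarith [ht₁.1, ht₂.1], ht₂.2⟩⟩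
      rw [hWt₂]; have := hhand; rw [hWt₂] at hZt₂; linarith
    have hInW : ∀ t ∈ Ico t₂ T, InW (9 / 10) (c t) :=
      inW_of_solution h11 (WK := 9 / 10) (by norm_num) (a := 0) (T := T) (t₀ := t₂)
        (by linarith [ht₁.1, ht₂.1]) hcd hUne hInW₂
    refine ⟨t₂, ⟨by linarith [ht₂.1, ht₁.1], ht₂.2⟩, by linarith, hInW₂, ?_, hInW⟩
    intro t ht
    rcases lt_or_ge t t₁ with h | h
    · exact Or.inl (Or.inl (hin1 t ⟨ht.1, h⟩))
    · rcases lt_or_ge t t₂ with h' | h'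
      · exact Or.inl (Or.inr (hin2 t ⟨h, h'⟩))
      · have : t = t₂ := le_antisymm ht.2 h'
        rw [this]; exact Or.inr (mem_Kc_of_inW (by norm_num) hInW₂)
  ------------------------------------------------------------------
  -- 5. conclusion: the maximal continuation of the branch is global
  ------------------------------------------------------------------
  rcases ODE.exists_maximal hF hδb hc₀d hc₀U with ⟨c, hce, hcd, hcU⟩ | ⟨b, hb, c, hce, hcd, hcU, hmax⟩
  swap
  · -- a finite maximal time is impossible
    exfalso
    obtain ⟨δ, hδ, hout⟩ :=
      ODE.eventually_not_mem_of_maximal isOpen_offSonic hF hKbigc hKbigU hcd hcU hmax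
    have ht₀b : t₀ < b := lt_of_lt_of_le ht₀δ hb
    obtain ⟨t₂, ht₂, _, hInW₂, _, hInW⟩ := key c b hce hcd hcU ht₀b (Or.inr ⟨δ, hδ, hout⟩)
    set t := max t₂ (b - δ / 2) with ht
    have ht1 : t₂ ≤ t := le_max_left _ _
    have ht2 : t < b := max_lt ht₂.2 (by linarith)
    have ht3 : b - δ < t := lt_of_lt_of_le (by linarith) (le_max_right _ _)
    exact hout t ⟨by linarith [ht₂.1], ht2⟩ ht3 (Or.inr (mem_Kc_of_inW (by norm_num) (hInW t ⟨ht1, ht2⟩)))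
  · -- the global solution
    have hcd' : ∀ T, ∀ t ∈ Ioo 0 T, HasDerivAt c (field r (c t)) t := fun T t ht => hcd t ht.1
    have hcU' : ∀ T, ∀ t ∈ Ioo 0 T, c t ∈ offSonic := fun T t ht => hcU t ht.1
    obtain ⟨t₂, ht₂, _, hInW₂, hKin, _⟩ :=
      key c (t₀ + (81 : ℝ)) hce (hcd' _) (hcU' _) (by linarith) (Or.inl le_rfl)
    have ht₂0 : 0 < t₂ := ht₀.trans ht₂.1
    have hUne : ∀ T, ∀ t ∈ Ioo 0 T, DW (c t).1 (c t).2 ≠ 0 ∧ DZ (c t).1 (c t).2 ≠ 0 :=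
      fun T t ht => hcU' T t ht
    have hInW : ∀ t, t₂ ≤ t → InW (9 / 10) (c t) := fun t ht =>
      inW_of_solution h11 (WK := 9 / 10) (by norm_num) (a := 0) (T := t + 1) (t₀ := t₂) ht₂0
        (hcd' _) (hUne _) hInW₂ t ⟨ht, by linarith⟩
    have hct₀ : c t₀ = (Wloc r t₀, Zloc r t₀) := hce ⟨ht₀, ht₀δ⟩
    have hdiag : ∀ t, 0 < t → (c t).2 < (c t).1 := fun t ht =>
      snd_lt_fst_of_solution (hcd' (max t t₀ + 1)) (hUne _) ⟨ht₀, by linarith [le_max_right t t₀]⟩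
        (by rw [hct₀]; exact (hbr' t₀ ht₀ ht₀δ.le).2.2.1) t ⟨ht, by linarith [le_max_left t t₀]⟩
    have hgood : ∀ t, 0 < t → 0 < DW (c t).1 (c t).2 ∧ 0 < DZ (c t).1 (c t).2 := by
      intro t ht
      rcases lt_or_ge t t₀ with h | h
      · have hct : c t = c₀ t := hce ⟨ht, h.trans ht₀δ⟩
        rw [hct]
        obtain ⟨k1, k2, _⟩ := hbr' t ht (h.le.trans ht₀δ.le)
        exact ⟨k1, k2⟩
      · rcases le_or_gt t t₂ with h' | h'
        · rcases hKin t ⟨h, h'⟩ with (hK | hK) | hK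
          · exact hR1D _ hK
          · exact hR2D _ hK
          · obtain ⟨k1, k2, k3, k4⟩ := hK
            exact ⟨by unfold DW; linarith, by unfold DZ; linarith⟩
        · obtain ⟨k1, k2, k3, k4⟩ := hInW t h'.le
          exact ⟨by unfold DW; linarith, by unfold DZ; linarith⟩
    -- exponential decay in the wedge and the limit
    have hr1 : 1 ≤ r := by linarith
    obtain ⟨κ, hκ⟩ : ∃ κ : ℝ, κ = (r - 1 / 24) / 2 := ⟨_, rfl⟩
    have hκ0 : 0 < κ := by rw [hκ]; linarith
    have hdecayW : ∀ t, t₂ ≤ t → (c t).1 ≤ (9 / 10) * Real.exp (-κ * (t - t₂)) := by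
      intro t ht
      have hexp : ∀ s, HasDerivAt (fun s => Real.exp (κ * (s - t₂))) (Real.exp (κ * (s - t₂)) * κ) s := by
        intro s
        have h1 : HasDerivAt (fun s => κ * (s - t₂)) κ s := by
          simpa using ((hasDerivAt_id s).sub_const t₂).const_mul κ
        exact h1.exp
      have hv : ∀ s, t₂ ≤ s → HasDerivAt (fun s => (c s).1 * Real.exp (κ * (s - t₂)))
          ((field r (c s)).1 * Real.exp (κ * (s - t₂)) + (c s).1 * (Real.exp (κ * (s - t₂)) * κ)) s :=
        fun s hs => HasDerivAt.mul (hcd s (show (0:ℝ) < s by linarith [ht₂0])).fst (hexp s)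
      have hanti : AntitoneOn (fun s => (c s).1 * Real.exp (κ * (s - t₂))) (Icc t₂ t) := by
        apply antitoneOn_of_deriv_nonpos (convex_Icc _ _)
        · exact fun s hs => (hv s hs.1).continuousAt.continuousWithinAt
        · rw [interior_Icc]; exact fun s hs => (hv s hs.1.le).differentiableAt.differentiableWithinAt
        · rw [interior_Icc]; intro s hs
          rw [(hv s hs.1.le).deriv]
          have h1 := field_fst_le (WK := 9 / 10) (by norm_num) hr1 (hInW s hs.1.le)
          have h3 := Real.exp_pos (κ * (s - t₂))
          have key' : (field r (c s)).1 + (c s).1 * κ ≤ 0 := by rw [hκ]; linarith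
          have e : (field r (c s)).1 * Real.exp (κ * (s - t₂)) + (c s).1 * (Real.exp (κ * (s - t₂)) * κ)
              = Real.exp (κ * (s - t₂)) * ((field r (c s)).1 + (c s).1 * κ) := by ring
          rw [e]
          exact mul_nonpos_of_nonneg_of_nonpos h3.le key'
      have hmon := hanti ⟨le_rfl, ht⟩ ⟨ht, le_rfl⟩ ht
      simp only [sub_self, mul_zero, Real.exp_zero, mul_one] at hmon
      have hW₂ : (c t₂).1 ≤ 9 / 10 := (hInW₂).2.1
      have h3 := Real.exp_pos (κ * (t - t₂))
      have e : Real.exp (-κ * (t - t₂)) * Real.exp (κ * (t - t₂)) = 1 := by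
        rw [← Real.exp_add]; simp
      calc (c t).1 = (c t).1 * Real.exp (κ * (t - t₂)) * Real.exp (-κ * (t - t₂)) := by
            rw [mul_assoc, mul_comm (Real.exp _), e, mul_one]
        _ ≤ (c t₂).1 * Real.exp (-κ * (t - t₂)) :=
            mul_le_mul_of_nonneg_right hmon (Real.exp_pos _).le
        _ ≤ 9 / 10 * Real.exp (-κ * (t - t₂)) :=
            mul_le_mul_of_nonneg_right hW₂ (Real.exp_pos _).le
    have hlimE : Tendsto (fun t => (3 / 2) * ((9 / 10) * Real.exp (-κ * (t - t₂)))) atTop (𝓝 0) := by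
      have h1 : Tendsto (fun t => -κ * (t - t₂)) atTop atBot := by
        have : Tendsto (fun t => t - t₂) atTop atTop := tendsto_atTop_add_const_right _ _ tendsto_id
        exact this.const_mul_atTop_of_neg (by linarith)
      have h2 := Real.tendsto_exp_atBot.comp h1
      simpa using (h2.const_mul (9 / 10 : ℝ)).const_mul (3 / 2 : ℝ)
    have hboundW : ∀ᶠ t in atTop, |(c t).1| ≤ (3 / 2) * ((9 / 10) * Real.exp (-κ * (t - t₂))) := by
      filter_upwards [eventually_ge_atTop t₂] with t ht
      obtain ⟨k1, _, _, _⟩ := hInW t ht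
      have := hdecayW t ht
      have h3 := Real.exp_pos (-κ * (t - t₂))
      rw [abs_of_pos k1]; nlinarith
    have hboundZ : ∀ᶠ t in atTop, |(c t).2| ≤ (3 / 2) * ((9 / 10) * Real.exp (-κ * (t - t₂))) := by
      filter_upwards [eventually_ge_atTop t₂] with t ht
      obtain ⟨k1, _, k3, k4⟩ := hInW t ht
      have := hdecayW t ht
      have h3 := Real.exp_pos (-κ * (t - t₂))
      exact abs_le.mpr ⟨by nlinarith, by nlinarith⟩
    have hlimW : Tendsto (fun t => (c t).1) atTop (𝓝 0) :=
      squeeze_zero_norm' (by simpa [Real.norm_eq_abs] using hboundW) hlimE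
    have hlimZ : Tendsto (fun t => (c t).2) atTop (𝓝 0) :=
      squeeze_zero_norm' (by simpa [Real.norm_eq_abs] using hboundZ) hlimE
    -- the data
    refine ⟨fun t => if t ≤ 0 then Wloc r t else (c t).1, fun t => if t ≤ 0 then Zloc r t else (c t).2,
      δb, hδb, ?_, ?_, ?_, ?_, ?_⟩
    · intro t ht
      rcases eq_or_lt_of_le ht.1 with h | h
      · simp [← h]
      · have hct : c t = c₀ t := hce ⟨h, ht.2⟩
        simp [not_le.mpr h, hct, hc₀]
    · intro t ht
      have ht' : (0:ℝ) < t := ht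
      have hev : ∀ᶠ x in 𝓝 t, ((fun t => if t ≤ 0 then Wloc r t else (c t).1) x,
          (fun t => if t ≤ 0 then Zloc r t else (c t).2) x) = c x := by
        filter_upwards [lt_mem_nhds ht'] with x hx
        simp [not_le.mpr hx]
      have hd := hcd t ht'
      have e : ((if t ≤ 0 then Wloc r t else (c t).1), (if t ≤ 0 then Zloc r t else (c t).2)) = c t := by
        simp [not_le.mpr ht']
      rw [e]
      exact hd.congr_of_eventuallyEq hev
    · intro t ht
      have ht' : (0:ℝ) < t := ht
      simp only [not_le.mpr ht', if_false]
      exact ⟨(hgood t ht').1, (hgood t ht').2, hdiag t ht'⟩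
    · refine hlimW.congr' ?_
      filter_upwards [eventually_gt_atTop 0] with t ht
      simp [not_le.mpr ht]
    · refine hlimZ.congr' ?_
      filter_upwards [eventually_gt_atTop 0] with t ht
      simp [not_le.mpr ht]

end LeftAsm

end Monatomic

end BuckmasterCaolaboraGomezserrano2025

end Literature.Analysis.FluidPDE
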